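import Literature.Geometry.Kaehler.ComplexTorusLineBundleIndexEndomorphismField
import Summits.Ventures.HSemireg.SecantParityObjectLevel
import HarnessLib

/-!
# Venture HSemireg — (S3)'s positivity input is AUTOMATIC when `End_ℚ(X) = ℚ`: on an abelian variety with no extra
# endomorphisms every non-zero `η ∈ NS(X)` has index `0` or `g`, hence `∫_X η^{∧g} > 0` at every even `g`; likewise under PICARD
# NUMBER ONE; the (H1) gate can only bite on abelian varieties with `ρ(X) ≥ 2` — TRACK S4-PUSH (ii), seat `s4-prove-1` (g9); file of record
# `s4push/prove-1/ATTEMPT-10.md` §2bis; file V-c of the lane's object-level series (III, IV, IVb, V-a, V-b)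

HONEST FRAMING. Lean index of the computation cell `pub-hsemireg`. OBJECT LEVEL in the sense of file III and only that object: the
complex torus `X = E/Φ(ℤ^ι)` of the tree's Literature layer (`Literature/Geometry/Kaehler/ComplexTorus*`, lane `lit-hodgefound`),
`∫_X := ComplexTorus.torusIntegral`, `ComplexTorus.IsNSForm`, the intrinsic index `ComplexTorus.hermIndex`, and the rational endomorphism
algebra `ComplexTorus.endAlgRat Φ ⊆ M_ι(ℚ)` (rational representation).  No sheaf, secant plane, Ext group or semiregularity map is
constructed; nothing here says that HC, HC_CM or HC_AV holds; nothing here is a new case of anything; (S3)'s signed words («PROVED given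
`∫bⁿ > 0`», STRUCTURE.md v1.0 §2; STATUS WORD s4-ref P-2) do not move.  NO definition, NO named fact: theorems only, all PROVED (0 sorry).

WHAT IS ADDED TO THE LANE'S RECORD (sheet `s4push/prove-1/STATEMENTS-S3INPUT.md`, row S3INP-11).  The tree's Literature theorem
`hermIndex_eq_zero_or_eq_finrank_of_endAlgRat_eq_bot` (Lange 2023 §2.6.3 Exercise (3), last clause: «In particular, if `End(X) = ℤ`, any
non-trivial line bundle is of index `0` or `g`», formalised by lane `lit-hodgefound`) is read through file III's criterion
`torusIntegral_wedgePow_pos_iff_even'` («`∫_X η^{∧g} > 0 ⟺ g + index` even»):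
* `nondegenerate_and_hermIndex_of_endAlgRat_eq_bot` — the Literature theorem with its rational-Gram binder discharged
  (`G₀ := ratGram Φ η₀`, tree `map_ratGram`): `X` abelian (`η₀` a Riemann form), `End_ℚ(X) = ℚ` (`endAlgRat Φ = ⊥`), `η ∈ NS(X)`,
  `η ≠ 0` ⇒ `η` non-degenerate and `hermIndex η ∈ {0, g}`;
* **`torusIntegral_wedgePow_pos_of_endAlgRat_eq_bot`** — … and `g` even ⇒ **`0 < ∫_X η^{∧g}`**: (H1) holds for EVERY non-zero `NS` class, of
  either sign, with no positivity datum at all; `torusIntegral_wedgePow_ne_zero_of_endAlgRat_eq_bot` (any `g`: `∫ ≠ 0`, the value being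
  `± g!·d₁⋯d_g`);
* the contrapositive **`endAlgRat_ne_bot_of_not_torusIntegral_wedgePow_pos`** — if some non-zero `η ∈ NS(X)` on an abelian variety of even
  dimension fails (H1) (`¬ 0 < ∫_X η^{∧g}`), then `End_ℚ(X) ≠ ℚ`: the (H1) gate can only bite in the presence of extra endomorphisms — which is
  where every census object lives (`E^n`, CM, Weil type) and where file V-b's classes of every index are built (`E_τ^g`, `ρ = g²` for CM `τ`).
* **`torusIntegral_wedgePow_pos_of_finrank_neronSeveriQ_eq_one`** — the weaker, classical hypothesis: PICARD NUMBER ONE (`dim_ℚ NS_ℚ(X) = 1`,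
  tree `neronSeveriQ`; rank-one ⇒ `η₀ = q·η`, `q ∈ ℚ^×`, then file III's rescaling) ⇒ (H1) for every non-zero `NS` class at even `g`;
  `finrank_neronSeveriQ_ne_one_of_not_torusIntegral_wedgePow_pos` (the gate bites only if `ρ(X) ≥ 2`).
(The sheet's §0 binder `b ∈ NS(X)_ℚ` is a non-zero rational multiple of an `NS` class; file III's `torusIntegral_wedgePow_smul_pos_iff` moves the
statement to `c·η`, `c ≠ 0` real, at even `g` — `torusIntegral_wedgePow_smul_pos_of_endAlgRat_eq_bot`.)

PRESEARCH (2026-08-23, g9): the statement is Lange's printed exercise (held text `book:lange1992-complex-abelian-varieties` p0147 (3)) and is a TREE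
THEOREM (`ComplexTorusLineBundleIndexEndomorphismField.lean`); this file only composes it with file III — no new mathematics, a scope sentence for (S3).

Statements and proofs: s4-prove-1 g9 (2026-08-23), seat ×1 + kernel; reads invited: s4-ref (statement read), s4-prove-3 (×2).

## References

* [Lange2023AbelianVarietiesComplex] H. Lange, Abelian Varieties over the Complex Numbers (2023), §2.6.3 Exercise (3) (p. 147), §2.4.2 Thm. 2.4.14,
  §1.6.2 (index), §1.7.2 Thm. 1.7.3 and Lemma 1.7.5 — held text `book:lange1992-complex-abelian-varieties`, as cited in the imported files.
* Cell records: STATEMENTS-S3INPUT.md rows S3INP-1, -7, -10, -11; ATTEMPT-10.md §2bis; file III `SecantParityObjectLevel.lean`.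
-/

noncomputable section

open scoped ComplexOrder
open Complex Module
open Literature.Geometry.Kaehler Literature.Geometry.Kaehler.ComplexTorus

namespace Summit.Ventures.HSemireg

namespace SecantParity

variable {ι : Type*} [Fintype ι] [DecidableEq ι] [Nonempty ι] {E : Type*} [NormedAddCommGroup E] [NormedSpace ℂ E]
  [FiniteDimensional ℂ E] (Φ : (ι → ℝ) ≃L[ℝ] E) {η₀ η : E [⋀^Fin 2]→L[ℝ] ℝ}

/-- **`End_ℚ(X) = ℚ` ⇒ every non-zero `η ∈ NS(X)` is non-degenerate of index `0` or `g`** — the tree's Literature theorem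
(Lange §2.6.3 Exercise (3), last clause) with its rational Gram binder discharged by `ratGram`.
[cite: Lange2023AbelianVarietiesComplex, §2.6.3 Exercise (3) and §2.4.2 Thm. 2.4.14] -/
theorem nondegenerate_and_hermIndex_of_endAlgRat_eq_bot (hR : IsRiemannForm Φ η₀) (hbot : endAlgRat Φ = ⊥)
    (hη : IsNSForm Φ η) (hne : η ≠ 0) :
    (∀ v : E, v ≠ 0 → ∃ u : E, η ![v, u] ≠ 0) ∧ (hermIndex η = 0 ∨ hermIndex η = finrank ℂ E) :=
  hermIndex_eq_zero_or_eq_finrank_of_endAlgRat_eq_bot Φ hR (map_ratGram Φ (mem_neronSeveriQ_of_isNSForm Φ hR.isNSForm))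
    hbot hη hne

omit [DecidableEq ι] [Nonempty ι] [FiniteDimensional ℂ E] in
/-- `dim_ℂ E = g` when the lattice of `X = E/Ψ(ℤ^ι)` has rank `2g` (`e : Fin (2g) ≃ ι`). [cite: Lange2023AbelianVarietiesComplex, §1.1.1] -/
theorem finrank_eq_of_equiv (Ψ : (ι → ℝ) ≃L[ℝ] E) {g : ℕ} (e : Fin (2 * g) ≃ ι) : finrank ℂ E = g := by
  have h2 : finrank ℝ E = 2 * finrank ℂ E := finrank_real_of_complex E
  have hΨ : finrank ℝ E = Fintype.card ι := by
    rw [← LinearEquiv.finrank_eq Ψ.toLinearEquiv, finrank_fintype_fun_eq_card]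
  have he : Fintype.card ι = 2 * g := by simpa using (Fintype.card_congr e).symm
  omega

/-- **(H1) IS AUTOMATIC WHEN `End_ℚ(X) = ℚ`.** `X` an abelian variety (`η₀` a Riemann form) with `endAlgRat Φ = ⊥`, `η ∈ NS(X)`,
`η ≠ 0`, `g = dim X` EVEN ⇒ `0 < ∫_X η^{∧g}` — for either sign of `η`, with no positivity datum. [cite: Lange2023AbelianVarietiesComplex, §2.6.3 Exercise (3) and §1.7.2 Thm. 1.7.3] -/
theorem torusIntegral_wedgePow_pos_of_endAlgRat_eq_bot (hR : IsRiemannForm Φ η₀) (hbot : endAlgRat Φ = ⊥)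
    (hη : IsNSForm Φ η) (hne : η ≠ 0) {g : ℕ} (hg : Even g) (e : Fin (2 * g) ≃ ι) :
    0 < torusIntegral Φ e (wedgePow (ofRealForm η) g) := by
  obtain ⟨hnd, hidx⟩ := nondegenerate_and_hermIndex_of_endAlgRat_eq_bot Φ hR hbot hη hne
  rw [torusIntegral_wedgePow_pos_iff_even' Φ hη hnd e]
  rcases hidx with h0 | hg'
  · rwa [h0, add_zero]
  · rw [hg', finrank_eq_of_equiv Φ e]
    exact hg.add hg

/-- … at ANY `g`: `∫_X η^{∧g} ≠ 0` (the value is `± g!·d₁⋯d_g`). [cite: Lange2023AbelianVarietiesComplex, §1.7.2 Lemma 1.7.5] -/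
theorem torusIntegral_wedgePow_ne_zero_of_endAlgRat_eq_bot (hR : IsRiemannForm Φ η₀) (hbot : endAlgRat Φ = ⊥)
    (hη : IsNSForm Φ η) (hne : η ≠ 0) {g : ℕ} (e : Fin (2 * g) ≃ ι) :
    torusIntegral Φ e (wedgePow (ofRealForm η) g) ≠ 0 := by
  obtain ⟨hnd, -⟩ := nondegenerate_and_hermIndex_of_endAlgRat_eq_bot Φ hR hbot hη hne
  obtain ⟨g', d, hd, hpos⟩ := hη.exists_isPolarizationType_of_nondegenerate Φ hnd
  have hg : g' = g := by
    have h' := hd.card_eq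
    have h2 : Fintype.card ι = 2 * g := by simpa using (Fintype.card_congr e).symm
    omega
  subst hg
  rw [hη.torusIntegral_wedgePow_of_isPolarizationType Φ hnd hd e]
  refine mul_ne_zero (mul_ne_zero (pow_ne_zero _ (by norm_num)) (by exact_mod_cast (Nat.factorial_pos _).ne')) ?_
  exact Finset.prod_ne_zero_iff.2 fun i _ ↦ by exact_mod_cast (hpos i).ne'

/-- **THE (H1) GATE BITES ONLY WITH EXTRA ENDOMORPHISMS**: if an abelian variety of even dimension `g` carries a non-zero
`η ∈ NS(X)` with `∫_X η^{∧g} ≤ 0` (or merely not `> 0`), then `End_ℚ(X) ≠ ℚ`.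
[cite: Lange2023AbelianVarietiesComplex, §2.6.3 Exercise (3) and §1.7.2 Thm. 1.7.3] -/
theorem endAlgRat_ne_bot_of_not_torusIntegral_wedgePow_pos (hR : IsRiemannForm Φ η₀) (hη : IsNSForm Φ η) (hne : η ≠ 0)
    {g : ℕ} (hg : Even g) (e : Fin (2 * g) ≃ ι) (h : ¬ 0 < torusIntegral Φ e (wedgePow (ofRealForm η) g)) :
    endAlgRat Φ ≠ ⊥ :=
  fun hbot ↦ h (torusIntegral_wedgePow_pos_of_endAlgRat_eq_bot Φ hR hbot hη hne hg e)

/-- … for the sheet's rational binder `b = c·η ∈ NS(X)_ℚ` (`c ≠ 0` real, `η ∈ NS(X)` non-zero): `End_ℚ(X) = ℚ`, `g` even ⇒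
`0 < ∫_X (c·η)^{∧g}`. [cite: Lange2023AbelianVarietiesComplex, §2.6.3 Exercise (3) and §1.7.2 Thm. 1.7.3] -/
theorem torusIntegral_wedgePow_smul_pos_of_endAlgRat_eq_bot (hR : IsRiemannForm Φ η₀) (hbot : endAlgRat Φ = ⊥)
    (hη : IsNSForm Φ η) (hne : η ≠ 0) {c : ℝ} (hc : c ≠ 0) {g : ℕ} (hg : Even g) (e : Fin (2 * g) ≃ ι) :
    0 < torusIntegral Φ e (wedgePow (ofRealForm (c • η)) g) := by
  rw [torusIntegral_wedgePow_smul_pos_iff Φ hc hg e]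
  exact torusIntegral_wedgePow_pos_of_endAlgRat_eq_bot Φ hR hbot hη hne hg e

/-! ### Picard number one: `NS_ℚ(X) = ℚ·θ` — the weaker, classical hypothesis under which (H1) is automatic -/

omit [Nonempty ι] [FiniteDimensional ℂ E] in
/-- **(H1) IS AUTOMATIC WHEN `ρ(X) = 1`.** `X` an abelian variety (`η₀` a Riemann form) with `dim_ℚ NS_ℚ(X) = 1` (Picard number one —
e.g. every abelian variety with `End_ℚ(X) = ℚ`, but also simple CM surfaces), `η ∈ NS(X)`, `η ≠ 0`, `g` even ⇒ `0 < ∫_X η^{∧g}`: indeed `η₀ = q·η`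
with `q ∈ ℚ^×` (rank one), and file III's rescaling `torusIntegral_wedgePow_smul_pos_iff` + `∫ η₀^{∧g} > 0` (Riemann form, even `g`).  So the
(H1) gate is void unless `ρ(X) ≥ 2`. [cite: Lange2023AbelianVarietiesComplex, §2.4.2 Prop. 2.4.12 and §1.7.2 Thm. 1.7.3] -/
theorem torusIntegral_wedgePow_pos_of_finrank_neronSeveriQ_eq_one (hR : IsRiemannForm Φ η₀)
    (hρ : finrank ℚ (neronSeveriQ Φ) = 1) (hη : IsNSForm Φ η) (hne : η ≠ 0) {g : ℕ} (hg : Even g)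
    (e : Fin (2 * g) ≃ ι) : 0 < torusIntegral Φ e (wedgePow (ofRealForm η) g) := by
  have hmem : η ∈ neronSeveriQ Φ := mem_neronSeveriQ_of_isNSForm Φ hη
  have h0mem : η₀ ∈ neronSeveriQ Φ := mem_neronSeveriQ_of_isNSForm Φ hR.isNSForm
  have hv : (⟨η, hmem⟩ : neronSeveriQ Φ) ≠ 0 := fun h ↦ hne (congrArg Subtype.val h)
  obtain ⟨q, hq⟩ := (finrank_eq_one_iff_of_nonzero' (⟨η, hmem⟩ : neronSeveriQ Φ) hv).1 hρ ⟨η₀, h0mem⟩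
  have hq' : (q : ℝ) • η = η₀ := by
    have h := congrArg Subtype.val hq
    simp only [Submodule.coe_smul_of_tower] at h
    rw [← h]
    ext v
    simp only [ContinuousAlternatingMap.smul_apply, smul_eq_mul, Rat.smul_def]
  -- `q ≠ 0`: otherwise `η₀ = 0`, impossible for a Riemann form unless `E = 0`, and then `η = 0`
  have hq0 : q ≠ 0 := by
    rintro rfl
    rw [Rat.cast_zero, zero_smul] at hq'
    apply hne
    ext v
    have hv0 : v 0 = 0 := by
      by_contra h0
      have hpos := hR.2.2 (v 0) h0
      rw [← hq', ContinuousAlternatingMap.coe_zero, Pi.zero_apply] at hpos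
      exact lt_irrefl _ hpos
    rw [ContinuousAlternatingMap.coe_zero, Pi.zero_apply]
    exact η.map_coord_zero 0 hv0
  have hη' : η = ((q : ℝ)⁻¹) • η₀ := by
    rw [← hq', smul_smul, inv_mul_cancel₀ (by exact_mod_cast hq0), one_smul]
  rw [hη', torusIntegral_wedgePow_smul_pos_iff Φ (inv_ne_zero (by exact_mod_cast hq0)) hg e]
  exact IsRiemannForm.torusIntegral_wedgePow_pos_of_even' Φ hR e hg

omit [Nonempty ι] [FiniteDimensional ℂ E] in
/-- … contrapositive: an abelian variety of even dimension carrying a non-zero `η ∈ NS(X)` that fails (H1) has Picard number `ρ(X) ≠ 1`.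
[cite: Lange2023AbelianVarietiesComplex, §2.4.2 Prop. 2.4.12 and §1.7.2 Thm. 1.7.3] -/
theorem finrank_neronSeveriQ_ne_one_of_not_torusIntegral_wedgePow_pos (hR : IsRiemannForm Φ η₀) (hη : IsNSForm Φ η)
    (hne : η ≠ 0) {g : ℕ} (hg : Even g) (e : Fin (2 * g) ≃ ι) (h : ¬ 0 < torusIntegral Φ e (wedgePow (ofRealForm η) g)) :
    finrank ℚ (neronSeveriQ Φ) ≠ 1 :=
  fun hρ ↦ h (torusIntegral_wedgePow_pos_of_finrank_neronSeveriQ_eq_one Φ hR hρ hη hne hg e)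

end SecantParity

end Summit.Ventures.HSemireg
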